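import Summits.MatrixMultiplication.OmegaCensus.STPP222Pow5AssemblyKit
import Summits.MatrixMultiplication.OmegaCensus.STPP222SqNoneBelow24

/-!
# ω-census, `(2,2,2)^k` in cyclic groups: Conjecture C8 — the CYCLIC COSET-ONSET LAW (statement; kernel instance `k = 2`)

HONEST FRAMING (pub-omega census; verbatim): lottery ticket; floor = certified bounds/negative ranges.  This file TYPES a
conjecture of the cell's STRUCTURE.md §2 (C8, registered 2026-08-24 together with prereg P-030; typing authorised by RULING
L25-1 (5), 2026-08-25) as a `Prop`; the law itself is NOT proved and NOT asserted.  What IS proved is bookkeeping: the `k = 2`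
instance (a finite statement the tree already decides), the coset structure of the tree's onset witnesses at `24 / 42 / 64 / 80`,
and the reduction of the `k = 3, 4, 5` instances to explicit negative ranges (engine facts of the census, taken as hypotheses).
Nothing here is progress on `ω`: a `(2,2,2)^k` family has volume `8k` and certifies no matrix-multiplication bound of interest.

OBJECTS (CKSU 2005 Def. 5.1, tree `IsSTPP`; `N5Kit.HasPow H k` = "`H` hosts `(2,2,2)^k`" = `k` simultaneous-TPP triples of
`2`-subsets, `STPP222Pow5AssemblyKit.lean`).  For even `m` write `n = m/2`; the subgroup of order two of `ℤ/m` is `{0, n}` and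
its cosets are the 2-sets `{x, x + n}` (`CosetOnset.IsHalfCoset`).  A `(2,2,2)^k` family of `ℤ/m` is a COSET FAMILY
(`CosetOnset.IsCosetFamily`) when EVERY TRIPLE contains such a coset in at least one of its three positions — the position may
vary with the triple (the `ℤ/80` witness below uses all three positions, `C,C,B,B,A`).  Under `IsSTPP` one triple never holds
two cosets (`CosetOnset.not_isHalfCoset_pair`: cosets `{x, x+n}`, `{y, y+n}` in two positions of one triple give the vanishing
Def-5.1 word `n + (−n) + 0` with `x ≠ x + n`), so "at least one" is "exactly one"; this is why the census gloss "every 2-set a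
coset" (STRUCTURE.md C8, prereg P-030 (ii)) is read PER TRIPLE, as the engines do (stpp-3 `t4inv --inv k`, ENG1 `c4x`
coset-restricted cells, OMEGA-TABLE N16 / Pb58).
  `CosetOnset.evenHosts k = {m | 0 < m, m even, ℤ/m hosts (2,2,2)^k}` and `CosetOnset.evenCosetHosts k = {m | 0 < m, m even,
ℤ/m hosts a COSET (2,2,2)^k family}`; `m = 0` is excluded on purpose (`ZMod 0 = ℤ` hosts every pattern and would be a junk
least element of the first set and never of the second).

C8 — THE CONJECTURE (`CyclicCosetOnsetLaw`): for every `k ≥ 2`, the least element of `evenHosts k` is the least element of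
`evenCosetHosts k` ("unrestricted even onset = coset onset", `m_k^{even} = m_k^{coset}`).  Equivalent elementary form
(`cyclicCosetOnsetLaw_iff`): an even `ℤ/m` hosting `(2,2,2)^k` with no smaller even host hosts a COSET family.  (Both sets are
non-empty for every `k` — large cyclic groups host everything, `exists_isSTPP_222pow_of_card_ge` — so the law is not vacuous;
that remark is not used below.)
  Fibre-lift sub-class (OMEGA-TABLE NR147, `STPPFiberLift.lean`): a coset family whose cosets occupy at most TWO of the three
positions is exactly the lift of a singleton-mixed `(1,2,2)/(2,1,2)/(2,2,1)` family of `ℤ/n` (`exists_isSTPP_222pow_zmod_two_mul`,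
descent `isSTPP_image_of_two_positions`); the law is typed for the wider per-triple class, which is the one the census measured.

MECHANISM (as far as identified; cell records, ENG1 gen 16): below the generic-density regime the difference `n` of order two is
the only collision-saving device seen in any witness (every even find at `80 – 96` is a coset family); NOT identified: a counting
argument producing the onsets `24, 42, 64, 80`.  FALSIFIER: one `k ≥ 2` and one even `m` with a `(2,2,2)^k` family in `ℤ/m`, no
family in any smaller even cyclic group, and no coset family in `ℤ/m`.

EVIDENCE LEDGER (cell ids; KERNEL = a tree theorem; ×n = n independent exact engines, outside the kernel):
* `k = 2`: onset `24` both ways — KERNEL, this file (`cyclicCosetOnsetLaw_two`: no abelian group of order `≤ 23` hosts `(2,2,2)²`,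
  `not_exists_isSTPP_222sq_of_card_le` of `STPP222SqNoneBelow24.lean`; coset family in `ℤ/24`, `CosetOnset.hasCosetPow_24_2`).
* `k = 3`: onset `42` both ways — census datum D1 (P-024 addendum: complete searches unrestricted and coset-restricted, stpp-3
  `t4tiles` / `mixlift`, ENG1 / ENG2 cells; `ℤ/24 … ℤ/31` are KERNEL-empty, `STPP222CubeNoneZ24 … Z31`); the tree's `ℤ/42`
  witness `exists_isSTPP_222cube_zmod42` IS a coset family (`CosetOnset.hasCosetPow_42_3`, positions `C,B,A`) ⇒
  `cyclicCosetOnsetLaw_three_of` reduces the instance to the negative range `ℤ/2 … ℤ/40` (even).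
* `k = 4`: onset `64` both ways — census D1 / NR145-class rows; the tree's `ℤ/64` witness `exists_isSTPP_222pow4_z64` IS a coset
  family (`CosetOnset.hasCosetPow_64_4`, positions `C,B,C,A`) ⇒ `cyclicCosetOnsetLaw_four_of`.
* `k = 5` — the FIRST FORWARD TEST (prereg P-030, sha16 63ead63667653b31, registered 2026-08-24T20:56Z before the deciding runs
  were authorised): `ℤ/64 … ℤ/79` host NO `(2,2,2)⁵` family — ENG1 `c4x 0.3` COMPLETE cells (NR145: `64 – 71` SIGNED ×3, `73` ×1;
  P-030.0/.1/.2/.3 HIT ×1 on `72 / 74 / 76 / 78`, the last = kit j234748 ∪ j238240: `2 314 / 2 314` units, `774 / 774` roots all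
  INFEASIBLE, `Σ 17 870 828 882 641` nodes, `298.28` core-h, lead + referee recounts 2026-08-25; odd `75 / 77 / 79` COMPLETE ×1),
  and `ℤ/80` hosts the coset family `exists_isSTPP_222pow5_zmod80` (KERNEL, Pb58; `CosetOnset.hasCosetPow_80_5`, positions
  `C,C,B,B,A`) ⇒ `m₅ = 80 =` coset onset (P-030.4 HIT ×1, N16) ⇒ `cyclicCosetOnsetLaw_five_of` reduces the `k = 5` instance to
  exactly the negative range `ℤ/36 … ℤ/78` (even; `m < 36` is excluded in the kernel by the packing bound `8k − 4 ≤ |G|`,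
  `card_ge_of_isSTPP_222pow`).
* counterexamples: none.  Status at typing: 5-surviving at grade ×1 (RULING L25-1 (5)); TYPED here, never asserted.

References: H. Cohn, R. Kleinberg, B. Szegedy, C. Umans, *Group-theoretic algorithms for matrix multiplication*, FOCS 2005
(arXiv:math/0511460), Def. 5.1.  Cell records: pub-omega HOME `STRUCTURE.md` §2 C8, `prereg/P-030.md`, OMEGA-TABLE rows N16, NR145,
NR147, Pb58; ENG1 records `code/eng1/results/stpp/p020/`.  Seat pub-omega-eng1 (gen 21), 2026-08-25.  Template: `BoxRatioSectionLaw.lean` (C9).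
-/

open Literature.Computability.AlgebraicComplexity Finset

namespace Summit.MatrixMultiplication.OmegaCensus

namespace CosetOnset

/-! ## 1. Coset families and the two onset sets -/

/-- `S ⊆ ℤ/m` is a COSET OF THE SUBGROUP OF ORDER TWO: `S = {x, x + m/2}` for some `x ∈ S`.  Meaningful for even `m ≥ 2`, where
`(m/2 : ℤ/m)` is the unique element of order `2`; for odd `m` it reads `{x, x + ⌊m/2⌋}` and for `m = 0` it says `S` is a singleton —
documented junk, never used by the law (which quantifies over even `m > 0`).  (pub-omega census C8; bookkeeping definition.) -/
def IsHalfCoset {m : ℕ} (S : Finset (ZMod m)) : Prop :=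
  ∃ x ∈ S, S = {x, x + ((m / 2 : ℕ) : ZMod m)}

/-- `IsHalfCoset S` is decidable (a bounded `∃` over `S` and a finset equality), so coset families are checked by `decide`. -/
instance IsHalfCoset.instDecidable {m : ℕ} (S : Finset (ZMod m)) : Decidable (IsHalfCoset S) :=
  inferInstanceAs (Decidable (∃ x ∈ S, S = {x, x + ((m / 2 : ℕ) : ZMod m)}))

/-- COSET FAMILY (pub-omega census C8 / OMEGA-TABLE N16 / engine mode `t4inv --inv k`): every triple of the family contains, in at
least one of its three positions, a coset `{x, x + m/2}` of the subgroup of order two.  The position may vary with the triple. -/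
def IsCosetFamily {m k : ℕ} (A B C : Fin k → Finset (ZMod m)) : Prop :=
  ∀ i, IsHalfCoset (A i) ∨ IsHalfCoset (B i) ∨ IsHalfCoset (C i)

/-- `IsCosetFamily A B C` is decidable (finitely many triples, three decidable disjuncts each). -/
instance IsCosetFamily.instDecidable {m k : ℕ} (A B C : Fin k → Finset (ZMod m)) : Decidable (IsCosetFamily A B C) :=
  inferInstanceAs (Decidable (∀ i, IsHalfCoset (A i) ∨ IsHalfCoset (B i) ∨ IsHalfCoset (C i)))

/-- `ℤ/m` HOSTS A COSET `(2,2,2)^k` FAMILY: `k` simultaneous-TPP triples of `2`-subsets of `ℤ/m` (CKSU 2005 Def. 5.1, tree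
`IsSTPP`) forming a coset family.  Compare `N5Kit.HasPow (ZMod m) k` (no coset condition). [cite: CohnKleinbergSzegedyUmans2005, Def. 5.1] -/
def HasCosetPow (m k : ℕ) : Prop :=
  ∃ A B C : Fin k → Finset (ZMod m), IsSTPP A B C ∧ (∀ i, #(A i) = 2 ∧ #(B i) = 2 ∧ #(C i) = 2) ∧ IsCosetFamily A B C

/-- The even moduli `m > 0` such that `ℤ/m` hosts `(2,2,2)^k` (unrestricted).  `m = 0` (`ZMod 0 = ℤ`) is excluded on purpose. -/
def evenHosts (k : ℕ) : Set ℕ := {m | 0 < m ∧ Even m ∧ N5Kit.HasPow (ZMod m) k}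

/-- The even moduli `m > 0` such that `ℤ/m` hosts a COSET `(2,2,2)^k` family. -/
def evenCosetHosts (k : ℕ) : Set ℕ := {m | 0 < m ∧ Even m ∧ HasCosetPow m k}

end CosetOnset

open CosetOnset

/-- **Conjecture C8 of the pub-omega census: the CYCLIC COSET-ONSET LAW** (STRUCTURE.md §2, registered 2026-08-24 with prereg P-030;
typed 2026-08-25, RULING L25-1 (5)).  For every `k ≥ 2`, the least even `m > 0` such that `ℤ/m` hosts `k` simultaneous-TPP triples of
`2`-subsets (`(2,2,2)^k`, CKSU Def. 5.1, tree `IsSTPP`) is also the least even `m > 0` such that `ℤ/m` hosts such a family in which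
every triple contains a coset `{x, x + m/2}` of the subgroup of order two: `IsLeast (evenHosts k) m → IsLeast (evenCosetHosts k) m`.
Fitted base `k = 2, 3, 4` (onsets `24, 42, 64`), first forward test `k = 5` (onset `80`, prereg P-030 HIT ×1); evidence ledger in the
module docstring.  OPEN — a `def`, never to be asserted without proof (CONVENTIONS §4). -/
def CyclicCosetOnsetLaw : Prop :=
  ∀ k : ℕ, 2 ≤ k → ∀ m : ℕ, IsLeast (evenHosts k) m → IsLeast (evenCosetHosts k) m

namespace CosetOnset

/-! ## 2. Sanity of the typing: inclusions, the elementary form, one coset per triple -/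

/-- A coset `(2,2,2)^k` family is in particular a `(2,2,2)^k` family. -/
theorem HasCosetPow.hasPow {m k : ℕ} (h : HasCosetPow m k) : N5Kit.HasPow (ZMod m) k := by
  obtain ⟨A, B, C, hS, hc, -⟩ := h
  exact ⟨A, B, C, hS, hc⟩

/-- `evenCosetHosts k ⊆ evenHosts k`; hence the unrestricted even onset is trivially `≤` the coset onset, and C8 is the reverse
inequality. -/
theorem evenCosetHosts_subset (k : ℕ) : evenCosetHosts k ⊆ evenHosts k :=
  fun _ ⟨h0, he, h⟩ => ⟨h0, he, h.hasPow⟩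

/-- If `m₀` hosts a coset family and no even `0 < m < m₀` hosts `(2,2,2)^k` at all, then `m₀` is the least element of BOTH onset sets. -/
theorem isLeast_of_mem_of_lowerBound {k m₀ : ℕ} (hmem : m₀ ∈ evenCosetHosts k) (hlb : m₀ ∈ lowerBounds (evenHosts k)) :
    IsLeast (evenHosts k) m₀ ∧ IsLeast (evenCosetHosts k) m₀ :=
  ⟨⟨evenCosetHosts_subset k hmem, hlb⟩, ⟨hmem, fun _ hm => hlb (evenCosetHosts_subset k hm)⟩⟩

/-- The instance of C8 at one `k`, from a coset host `m₀` below which no even cyclic group hosts `(2,2,2)^k`. -/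
theorem law_at_of_mem_of_lowerBound {k m₀ : ℕ} (hmem : m₀ ∈ evenCosetHosts k) (hlb : m₀ ∈ lowerBounds (evenHosts k)) :
    ∀ m, IsLeast (evenHosts k) m → IsLeast (evenCosetHosts k) m := by
  intro m hm
  obtain ⟨h₁, h₂⟩ := isLeast_of_mem_of_lowerBound hmem hlb
  rwa [hm.unique h₁]

/-- A negative range `∀ even m, 0 < m < m₀ → ℤ/m hosts no (2,2,2)^k` makes `m₀` a lower bound of `evenHosts k`. -/
theorem mem_lowerBounds_evenHosts_of {k m₀ : ℕ} (h : ∀ m, 0 < m → Even m → m < m₀ → ¬ N5Kit.HasPow (ZMod m) k) :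
    m₀ ∈ lowerBounds (evenHosts k) :=
  fun m ⟨h0, he, hP⟩ => not_lt.1 fun hlt => h m h0 he hlt hP

/-- In an STPP family of `ℤ/m` (`m > 0` even) no triple with non-empty sets holds cosets of the order-two subgroup in TWO positions:
two cosets `{x, x + n}`, `{y, y + n}` (`n = m/2 ≠ 0`) produce the vanishing Def-5.1 word `n + (−n) + 0 = 0` inside the triple with
`x ≠ x + n`, contradicting the triple product property.  Hence "every triple contains a coset" = "every triple contains exactly one
coset", the reading of the census gloss used in `IsCosetFamily`. [cite: CohnKleinbergSzegedyUmans2005, Def. 5.1] -/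
theorem not_isHalfCoset_pair {m k : ℕ} (hm0 : 0 < m) (hme : Even m) {A B C : Fin k → Finset (ZMod m)} (hS : IsSTPP A B C)
    (i : Fin k) (hA : (A i).Nonempty) (hB : (B i).Nonempty) (hC : (C i).Nonempty) :
    ¬ (IsHalfCoset (A i) ∧ IsHalfCoset (B i)) ∧ ¬ (IsHalfCoset (B i) ∧ IsHalfCoset (C i)) ∧
      ¬ (IsHalfCoset (A i) ∧ IsHalfCoset (C i)) := by
  set n : ZMod m := ((m / 2 : ℕ) : ZMod m) with hn_def
  have hn : n ≠ 0 := by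
    rw [hn_def, Ne, ZMod.natCast_eq_zero_iff]
    intro hd
    obtain ⟨r, hr⟩ := hme
    have h1 : 0 < m / 2 := by omega
    have h2 := Nat.le_of_dvd h1 hd
    omega
  have memA : ∀ {x : ZMod m}, A i = {x, x + n} → x ∈ A i ∧ x + n ∈ A i := fun h => by rw [h]; simp
  have memB : ∀ {x : ZMod m}, B i = {x, x + n} → x ∈ B i ∧ x + n ∈ B i := fun h => by rw [h]; simp
  have memC : ∀ {x : ZMod m}, C i = {x, x + n} → x ∈ C i ∧ x + n ∈ C i := fun h => by rw [h]; simp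
  refine ⟨?_, ?_, ?_⟩
  · rintro ⟨⟨x, -, hx⟩, ⟨y, -, hy⟩⟩
    obtain ⟨c, hc⟩ := hC
    -- s = x, s' = x + n ∈ A i;  t = y + n, t' = y ∈ B i;  u = u' = c ∈ C i :  word = n + (-n) + 0
    have h := hS i i i x (memA hx).1 (x + n) (memA hx).2 (y + n) (memB hy).2 y (memB hy).1 c hc c hc (by ring)
    exact hn (by linear_combination -h.2.2.1)
  · rintro ⟨⟨y, -, hy⟩, ⟨c, -, hc⟩⟩
    obtain ⟨x, hx⟩ := hA
    -- s = s' = x;  t = y, t' = y + n;  u = c + n, u' = c :  word = 0 + n + (-n)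
    have h := hS i i i x hx x hx y (memB hy).1 (y + n) (memB hy).2 (c + n) (memC hc).2 c (memC hc).1 (by ring)
    exact hn (by linear_combination -h.2.2.2.1)
  · rintro ⟨⟨x, -, hx⟩, ⟨c, -, hc⟩⟩
    obtain ⟨y, hy⟩ := hB
    -- s = x, s' = x + n;  t = t' = y;  u = c + n, u' = c :  word = n + 0 + (-n)
    have h := hS i i i x (memA hx).1 (x + n) (memA hx).2 y hy y hy (c + n) (memC hc).2 c (memC hc).1 (by ring)
    exact hn (by linear_combination -h.2.2.1)

end CosetOnset

/-- **Elementary form of C8.**  `CyclicCosetOnsetLaw` says exactly: for every `k ≥ 2` and every even `m > 0`, if `ℤ/m` hosts `(2,2,2)^k`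
and no even `ℤ/m'` with `0 < m' < m` does, then `ℤ/m` hosts a COSET `(2,2,2)^k` family. -/
theorem cyclicCosetOnsetLaw_iff :
    CyclicCosetOnsetLaw ↔ ∀ k, 2 ≤ k → ∀ m, 0 < m → Even m → N5Kit.HasPow (ZMod m) k →
      (∀ m', 0 < m' → Even m' → m' < m → ¬ N5Kit.HasPow (ZMod m') k) → HasCosetPow m k := by
  constructor
  · intro h k hk m h0 he hP hmin
    have hl : IsLeast (evenHosts k) m := ⟨⟨h0, he, hP⟩, mem_lowerBounds_evenHosts_of hmin⟩
    exact (h k hk m hl).1.2.2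
  · intro h k hk m hl
    obtain ⟨⟨h0, he, hP⟩, hlb⟩ := hl
    refine ⟨⟨h0, he, h k hk m h0 he hP fun m' h0' he' hlt hP' => ?_⟩, fun m' hm' => hlb (evenCosetHosts_subset k hm')⟩
    exact absurd (hlb ⟨h0', he', hP'⟩) (not_le.2 hlt)

namespace CosetOnset

/-! ## 3. The onset witnesses of the census are coset families (kernel) -/

/-- Packaging: lists accepted by the Boolean Def-5.1 checker `stppCheck`, enumerating 2-sets that form a coset family, give
`HasCosetPow m k`. [cite: CohnKleinbergSzegedyUmans2005, Def. 5.1] -/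
theorem hasCosetPow_of_lists {m k : ℕ} (LA LB LC : Fin k → List (ZMod m)) (hS : stppCheck LA LB LC = true)
    (hc : ∀ i, #(LA i).toFinset = 2 ∧ #(LB i).toFinset = 2 ∧ #(LC i).toFinset = 2)
    (hcos : IsCosetFamily (fun i => (LA i).toFinset) (fun i => (LB i).toFinset) fun i => (LC i).toFinset) :
    HasCosetPow m k :=
  ⟨_, _, _, isSTPP_of_stppCheck hS, hc, hcos⟩

/-- `ℤ/24` hosts a COSET `(2,2,2)²` family: `A = {0,12},{0,12}`, `B = {0,1},{4,5}`, `C = {0,2},{8,10}` (cosets in positions `A,A`;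
found by this seat's literal Def-5.1 searcher, ENG1 gen 21, 2026-08-25; kernel `decide`). [cite: CohnKleinbergSzegedyUmans2005, Def. 5.1] -/
theorem hasCosetPow_24_2 : HasCosetPow 24 2 :=
  hasCosetPow_of_lists (m := 24) ![[0, 12], [0, 12]] ![[0, 1], [4, 5]] ![[0, 2], [8, 10]]
    (by decide +kernel) (by decide +kernel) (by decide +kernel)

/-- `ℤ/42` hosts a COSET `(2,2,2)³` family — the SAME lists as the tree's onset witness `exists_isSTPP_222cube_zmod42`
(`STPP222CubeBelow46.lean`; cosets `{0,21}`, `{8,29}`, `{0,21}` in positions `C,B,A`). [cite: CohnKleinbergSzegedyUmans2005, Def. 5.1] -/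
theorem hasCosetPow_42_3 : HasCosetPow 42 3 :=
  hasCosetPow_of_lists (m := 42) ![[0, 1], [0, 13], [0, 21]] ![[0, 3], [8, 29], [17, 39]] ![[0, 21], [1, 40], [4, 33]]
    (by decide +kernel) (by decide +kernel) (by decide +kernel)

set_option maxHeartbeats 400000 in
/-- `ℤ/64` hosts a COSET `(2,2,2)⁴` family — the SAME lists as the tree's onset witness `exists_isSTPP_222pow4_z64`
(`STPP222Pow4SeedsF.lean`; cosets `{0,32}`, `{48,16}`, `{20,52}`, `{0,32}` in positions `C,B,C,A`). [cite: CohnKleinbergSzegedyUmans2005, Def. 5.1] -/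
theorem hasCosetPow_64_4 : HasCosetPow 64 4 :=
  hasCosetPow_of_lists (m := 64) ![[0, 1], [0, 1], [0, 2], [0, 32]] ![[0, 2], [48, 16], [61, 62], [55, 57]]
    ![[0, 32], [10, 12], [20, 52], [35, 36]]
    (by decide +kernel) (by decide +kernel) (by decide +kernel)

set_option maxHeartbeats 400000 in
/-- `ℤ/80` hosts a COSET `(2,2,2)⁵` family — the SAME lists as the tree's onset witness `exists_isSTPP_222pow5_zmod80`
(`STPP222Pow5CyclicWitnesses9294.lean`, kit j214393; cosets `{0,40}`, `{10,50}`, `{57,17}`, `{47,7}`, `{0,40}` in positions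
`C,C,B,B,A` — all three positions occur, so this family is NOT in the fibre-lift sub-class of NR147). [cite: CohnKleinbergSzegedyUmans2005, Def. 5.1] -/
theorem hasCosetPow_80_5 : HasCosetPow 80 5 :=
  hasCosetPow_of_lists (m := 80) ![[0, 2], [0, 2], [0, 18], [0, 18], [0, 40]] ![[0, 4], [68, 72], [57, 17], [47, 7], [74, 76]]
    ![[0, 40], [10, 50], [5, 9], [73, 77], [23, 41]]
    (by decide +kernel) (by decide +kernel) (by decide +kernel)

/-! ## 4. Instances: `k = 2` in the kernel; `k = 3, 4, 5` modulo the census's negative ranges -/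

/-- `24 ∈ evenCosetHosts 2`, `42 ∈ evenCosetHosts 3`, `64 ∈ evenCosetHosts 4`, `80 ∈ evenCosetHosts 5`. -/
theorem mem_evenCosetHosts_onsets :
    24 ∈ evenCosetHosts 2 ∧ 42 ∈ evenCosetHosts 3 ∧ 64 ∈ evenCosetHosts 4 ∧ 80 ∈ evenCosetHosts 5 :=
  ⟨⟨by omega, ⟨12, rfl⟩, hasCosetPow_24_2⟩, ⟨by omega, ⟨21, rfl⟩, hasCosetPow_42_3⟩, ⟨by omega, ⟨32, rfl⟩, hasCosetPow_64_4⟩,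
    ⟨by omega, ⟨40, rfl⟩, hasCosetPow_80_5⟩⟩

/-- KERNEL: no even (indeed no) `ℤ/m` with `0 < m ≤ 23` hosts `(2,2,2)²` (`STPP222SqNoneBelow24.lean`), so `24` bounds `evenHosts 2`
below. -/
theorem mem_lowerBounds_evenHosts_two : 24 ∈ lowerBounds (evenHosts 2) := by
  refine mem_lowerBounds_evenHosts_of fun m h0 _ hlt hP => ?_
  haveI : NeZero m := ⟨h0.ne'⟩
  exact not_exists_isSTPP_222sq_of_card_le (G := ZMod m) (by rw [Nat.card_zmod]; omega) hP

/-- **The `k = 2` row of C8, KERNEL: `24` is the least even modulus hosting `(2,2,2)²` AND the least even modulus hosting a coset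
`(2,2,2)²` family.** [cite: CohnKleinbergSzegedyUmans2005, Def. 5.1] -/
theorem isLeast_evenHosts_two : IsLeast (evenHosts 2) 24 ∧ IsLeast (evenCosetHosts 2) 24 :=
  isLeast_of_mem_of_lowerBound mem_evenCosetHosts_onsets.1 mem_lowerBounds_evenHosts_two

end CosetOnset

/-- **C8 holds at `k = 2` (KERNEL, unconditional).** -/
theorem cyclicCosetOnsetLaw_two : ∀ m, IsLeast (evenHosts 2) m → IsLeast (evenCosetHosts 2) m :=
  law_at_of_mem_of_lowerBound mem_evenCosetHosts_onsets.1 mem_lowerBounds_evenHosts_two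

/-- C8 at `k = 3`, REDUCED: it holds as soon as no even `ℤ/m`, `0 < m < 42`, hosts `(2,2,2)³` (census datum D1: complete searches,
outside the kernel except `ℤ/24 … ℤ/31`, `STPP222CubeNoneZ24 … Z31`).  The coset witness at `42` is `CosetOnset.hasCosetPow_42_3`. -/
theorem cyclicCosetOnsetLaw_three_of (h : ∀ m, 0 < m → Even m → m < 42 → ¬ N5Kit.HasPow (ZMod m) 3) :
    ∀ m, IsLeast (evenHosts 3) m → IsLeast (evenCosetHosts 3) m :=
  law_at_of_mem_of_lowerBound mem_evenCosetHosts_onsets.2.1 (mem_lowerBounds_evenHosts_of h)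

/-- C8 at `k = 4`, REDUCED: it holds as soon as no even `ℤ/m`, `0 < m < 64`, hosts `(2,2,2)⁴` (census datum D1 / NR145-class rows,
engine-complete, outside the kernel).  The coset witness at `64` is `CosetOnset.hasCosetPow_64_4`. -/
theorem cyclicCosetOnsetLaw_four_of (h : ∀ m, 0 < m → Even m → m < 64 → ¬ N5Kit.HasPow (ZMod m) 4) :
    ∀ m, IsLeast (evenHosts 4) m → IsLeast (evenCosetHosts 4) m :=
  law_at_of_mem_of_lowerBound mem_evenCosetHosts_onsets.2.2.1 (mem_lowerBounds_evenHosts_of h)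

/-- C8 at `k = 5` — the forward test P-030 — REDUCED to exactly the census's negative range: it holds as soon as no even `ℤ/m`,
`36 ≤ m < 80`, hosts `(2,2,2)⁵` (ENG1 `c4x` COMPLETE cells `64 – 78`, NR145 / P-030.0–.3, and the `k = 4` negatives below `64`; all
outside the kernel).  Moduli `m < 36 = 8·5 − 4` are excluded in the kernel by the packing bound `card_ge_of_isSTPP_222pow`; the coset
witness at `80` is `CosetOnset.hasCosetPow_80_5`. -/
theorem cyclicCosetOnsetLaw_five_of (h : ∀ m, Even m → 36 ≤ m → m < 80 → ¬ N5Kit.HasPow (ZMod m) 5) :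
    ∀ m, IsLeast (evenHosts 5) m → IsLeast (evenCosetHosts 5) m := by
  refine law_at_of_mem_of_lowerBound mem_evenCosetHosts_onsets.2.2.2 (mem_lowerBounds_evenHosts_of fun m h0 he hlt hP => ?_)
  by_cases h36 : 36 ≤ m
  · exact h m he h36 hlt hP
  · haveI : NeZero m := ⟨h0.ne'⟩
    obtain ⟨A, B, C, hS, hc⟩ := hP
    have hcard := card_ge_of_isSTPP_222pow hS hc
    rw [ZMod.card] at hcard
    omega

end Summit.MatrixMultiplication.OmegaCensus
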